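import Mathlib
import Summits.MatrixMultiplication.MatrixMultiplication.Theorems.LevelGradedCohnUmansLevelOneGL2DesignsStubTangencySetsHermitianPolarityCap

/-!
# Stub `stub_tangencySets` (crux `LevelOneGL2Designs`, stmt-MatrixMultiplication-14080) —
wall-breaker axis 1/12 "Hermitian unital constructions" (gen 1, seat 2), part A′: the self-adjoint
slice of the rank-three normal form

Parts C/C′ put the wall in matrix form (zero diagonal, nowhere-zero off-diagonal, rank `≤ 3`, window
`[c·p^{5/4}, p^{3/2}+p+2]`); part A capped designs carried by a symmetric polarity at `p + 1`.  This
file states part A in the matrix language, closing the circle: **a SYMMETRIC square matrix over a finite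
field with `2 ≠ 0`, zero diagonal, nowhere-zero off-diagonal and rank `≤ 3` has at most `|F| + 1` rows**
(`symmetric_rankThree_card_le`; over `ZMod p`: `≤ p + 1`, `symmetric_rankThree_card_le_zmod`).  This is
the precise sense in which "Hermitian unital constructions over the prime field" — self-adjoint
solutions of the normal form for the field's only involution — are conic-sized, while the Frobenius
slice over `𝔽_{q²}` reaches `q³ + 1` and the unrestricted problem is the open stub.

Proof: the principal `3 × 3` block on three indices is `[[0,a,b],[a,0,c],[b,c,0]]` with `abc ≠ 0`, so
(using `2 ≠ 0`) the three rows are linearly independent and, the rank being `≤ 3`, span all rows: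
`E i = x_i E i₁ + y_i E i₂ + z_i E i₃`.  Symmetry then gives `E i j = w_iᵀ M w_j` with
`w_i = (x_i,y_i,z_i)` and `M` that block, and `polarity_isotropic_card_le` (part A) applies.
Mathlib + part A; no new definitions.
-/

set_option linter.dupNamespace false

namespace Summit.MatrixMultiplication.MatrixMultiplication.Theorems.LevelOneGL2Designs.HermitianUnital

open Finset Matrix Module

variable {F : Type*} [Field F]

/-- **Self-adjoint slice of the normal form.**  A symmetric square matrix over a finite field with
`2 ≠ 0`, zero diagonal, nowhere-zero off-diagonal and rank `≤ 3` has at most `|F| + 1` rows (and the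
conic shows `|F| + 1` is attained projectively).  [this file, from `polarity_isotropic_card_le`] -/
theorem symmetric_rankThree_card_le [Fintype F] [DecidableEq F] (h2 : (2 : F) ≠ 0)
    {ι : Type*} [Fintype ι] [DecidableEq ι] (E : Matrix ι ι F) (hsymm : E.IsSymm)
    (h0 : ∀ i, E i i = 0) (h1 : ∀ i j, i ≠ j → E i j ≠ 0) (hE : E.rank ≤ 3) :
    Fintype.card ι ≤ Fintype.card F + 1 := by
  classical
  have hF : 1 < Fintype.card F := Fintype.one_lt_card
  by_cases hsmall : Fintype.card ι ≤ 2
  · omega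
  obtain ⟨i₁, i₂, i₃, h12, h13, h23⟩ := (Fintype.two_lt_card_iff (α := ι)).mp (by omega)
  have hs : ∀ i j, E i j = E j i := fun i j => by
    simpa using congrFun (congrFun hsymm j) i
  set a := E i₁ i₂ with ha
  set b := E i₁ i₃ with hb
  set c := E i₂ i₃ with hc
  have ha0 : a ≠ 0 := h1 _ _ h12
  have hb0 : b ≠ 0 := h1 _ _ h13
  have hc0 : c ≠ 0 := h1 _ _ h23
  -- the three rows are linearly independent
  let v : Fin 3 → ι → F := ![E i₁, E i₂, E i₃]
  have hli : LinearIndependent F v := by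
    rw [Fintype.linearIndependent_iff]
    intro g hg
    have e : ∀ k, g 0 * E i₁ k + g 1 * E i₂ k + g 2 * E i₃ k = 0 := by
      intro k
      have := congrFun hg k
      simpa [v, Fin.sum_univ_three] using this
    have e1 := e i₁
    have e2 := e i₂
    have e3 := e i₃
    rw [h0 i₁, hs i₂ i₁, hs i₃ i₁] at e1
    rw [h0 i₂, hs i₃ i₂] at e2
    rw [h0 i₃] at e3
    -- e1 : g0*0 + g1*a + g2*b = 0 ; e2 : g0*a + g1*0 + g2*c = 0 ; e3 : g0*b + g1*c + g2*0 = 0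
    have hg0 : 2 * g 0 * (a * b) = 0 := by linear_combination a * e3 - (c * e1 - b * e2)
    have hg1 : 2 * g 1 * (a * c) = 0 := by linear_combination a * e3 + (c * e1 - b * e2)
    have g0 : g 0 = 0 := by
      rcases mul_eq_zero.mp hg0 with h | h
      · exact (mul_eq_zero.mp h).resolve_left h2
      · exact absurd h (mul_ne_zero ha0 hb0)
    have g1 : g 1 = 0 := by
      rcases mul_eq_zero.mp hg1 with h | h
      · exact (mul_eq_zero.mp h).resolve_left h2
      · exact absurd h (mul_ne_zero ha0 hc0)
    have g2 : g 2 = 0 := by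
      rw [g1] at e1
      have : g 2 * b = 0 := by linear_combination e1
      exact (mul_eq_zero.mp this).resolve_right hb0
    intro k
    fin_cases k
    · exact g0
    · exact g1
    · exact g2
  -- hence they span the row space
  have hspan : Submodule.span F (Set.range E) = Submodule.span F (Set.range v) := by
    symm
    apply Submodule.eq_of_le_of_finrank_le
    · apply Submodule.span_mono
      rintro _ ⟨k, rfl⟩
      fin_cases k
      · exact ⟨i₁, rfl⟩
      · exact ⟨i₂, rfl⟩
      · exact ⟨i₃, rfl⟩
    · rw [finrank_span_eq_card hli, Fintype.card_fin]
      have : E.rank = finrank F (Submodule.span F (Set.range E)) := rank_eq_finrank_span_row E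
      omega
  have hrow : ∀ i, ∃ g : Fin 3 → F, E i = g 0 • E i₁ + g 1 • E i₂ + g 2 • E i₃ := by
    intro i
    have hi : E i ∈ Submodule.span F (Set.range v) := by
      rw [← hspan]
      exact Submodule.subset_span ⟨i, rfl⟩
    obtain ⟨g, hg⟩ := (Submodule.mem_span_range_iff_exists_fun F).mp hi
    refine ⟨g, ?_⟩
    rw [← hg]
    simp only [v, Fin.sum_univ_three, cons_val_zero, cons_val_one]
    rfl
  choose g hg using hrow
  -- coordinates and the Gram form
  have hE : ∀ i j, E i j = g i 0 * E i₁ j + g i 1 * E i₂ j + g i 2 * E i₃ j := by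
    intro i j
    have := congrFun (hg i) j
    simpa using this
  have hc1 : ∀ j, E i₁ j = g j 1 * a + g j 2 * b := by
    intro j
    rw [hs i₁ j, hE j i₁, h0 i₁, hs i₂ i₁, hs i₃ i₁]
    ring
  have hc2 : ∀ j, E i₂ j = g j 0 * a + g j 2 * c := by
    intro j
    rw [hs i₂ j, hE j i₂, h0 i₂, hs i₃ i₂]
    ring
  have hc3 : ∀ j, E i₃ j = g j 0 * b + g j 1 * c := by
    intro j
    rw [hs i₃ j, hE j i₃, h0 i₃]
    ring
  let M : Matrix (Fin 3) (Fin 3) F := !![0, a, b; a, 0, c; b, c, 0]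
  have hM : M.IsSymm := by
    ext i j
    fin_cases i <;> fin_cases j <;> rfl
  let w : ι → Fin 3 → F := fun i => ![g i 0, g i 1, g i 2]
  have hgram : ∀ i j, w i ⬝ᵥ (M *ᵥ w j) = E i j := by
    intro i j
    rw [hE i j, hc1 j, hc2 j, hc3 j]
    simp [w, M, mulVec, dotProduct, Fin.sum_univ_three]
    ring
  refine polarity_isotropic_card_le h2 hM w (fun i => ?_) (fun i j hij => ?_)
  · rw [hgram, h0]
  · rw [hgram]
    exact h1 i j hij

/-- The prime-field instance: over `ZMod p`, `p` an odd prime, a symmetric zero-diagonal nowhere-zero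
matrix of rank `≤ 3` has at most `p + 1` rows — versus `≥ c·p^{5/4}` rows without the symmetry
(`exists_rankThree_card_ge`) and `q³ + 1` for the Frobenius-Hermitian slice over `𝔽_{q²}`.
[this file] -/
theorem symmetric_rankThree_card_le_zmod (p : ℕ) [hp : Fact p.Prime] (hp2 : p ≠ 2)
    {ι : Type*} [Fintype ι] [DecidableEq ι] (E : Matrix ι ι (ZMod p)) (hsymm : E.IsSymm)
    (h0 : ∀ i, E i i = 0) (h1 : ∀ i j, i ≠ j → E i j ≠ 0) (hE : E.rank ≤ 3) :
    Fintype.card ι ≤ p + 1 := by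
  have h2 : (2 : ZMod p) ≠ 0 := by
    intro h
    have h' : ((2 : ℕ) : ZMod p) = 0 := by exact_mod_cast h
    rw [ZMod.natCast_eq_zero_iff] at h'
    rcases Nat.prime_two.eq_one_or_self_of_dvd p h' with h1' | h1'
    · exact hp.out.ne_one h1'
    · exact hp2 h1'
  have h := symmetric_rankThree_card_le h2 E hsymm h0 h1 hE
  rwa [ZMod.card] at h

end Summit.MatrixMultiplication.MatrixMultiplication.Theorems.LevelOneGL2Designs.HermitianUnital
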